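import Literature.MathematicalPhysics.QuantumFieldTheory.Balaban1983to89.B12Eq43ContourFormula
import Literature.MathematicalPhysics.QuantumFieldTheory.Balaban1983to89.B12Eq44Ball

/-!
# Bałaban, *Renormalization group approach to lattice gauge field theories. I* (CMP 109, 1987) [Balaban1987RG1], §4 p. 281:
# the whole chain (4.3) ON THE CONCRETE (4.4)-CARRIER of [I] — the outer map `𝐀 ↦ 𝐄^{(j)}(X, exp iξ𝐀)` of `B12Eq44Ball`

HONEST FRAMING (cell `lit-balaban`, verbatim): statement-level skeleton of published theorems with citation tags; proofs where landed; nothing here is a claim about the Yang–Mills mass gap.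

PDF held: `paper:balaban1987-cmp109-rg-i-small-field` (journal page = PDF page + 248); p. 281 [PDF 33] read as an image by this
seat (render `pub-balaban/b2b-balaban-ref1/pages/1987-cmp109-rg-I-small-field/…-p033-x2.png`, 2026-08-21).

WHAT IS REPRODUCED: SKELETON row **B12.Eq4.2-4.3** (display owner r09, fold owner r20; referee ref-5) — the display (4.3) p. 281
(quoted in full in the header of `…B12Eq43ContourFormula`), members 1, 2 and 3, INSTANTIATED at the concrete outer map of record:
p. 281 *«In the last formula above we have the function 𝐄^{(j)}(X, exp iξ𝐀), i.e. the function with 𝐔 = 1, 𝐉 = 0. Thus it is defined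
and analytic on the space of configurations 𝐀 satisfying max{|𝐀|_X, |P₁(□₀)𝐀|_X, |∇^ξ𝐀|_X, |Δ^ξ𝐀|_X} < α₂. (4.4)»* — in the tree
`B12Eq44Ball.analyticOnNhd_E_sub310_one_ball` (p05 g7): `𝐀 ↦ E((exp iξ𝐀, J(exp iξ𝐀)))` pulled back to the (4.4)-normed space
`Cfg44 π P ξ (landauSub 𝓜 R ξ)` of `𝔤ᶜ`-valued Landau-gauge configurations on the torus block of `B12RegularSpaces111` is analytic on
the open ball `{‖𝐀‖₍₄.₄₎ < α₂}`, from the p. 263 hypothesis «E^{(j)} analytic on U^c_j(X, α₀, α₁)», condition (iv) of (1.11) as data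
and an explicit `α₂`-restriction (hypotheses kept BY NAME, exactly those of that theorem).

WHAT IS CERTIFIED (kernel, sorry-free; axioms standard; theorems only, no definition, no new named fact):
* **`eq42_concrete`** — the display (4.2) p. 281, *«Using the gauge transformation in (3.37), and the gauge invariance of the function
  𝐄^{(j)}(X, U), we have 𝐄^{(j)}(X, U_j(□₀, exp iB)) = 𝐄^{(j)}(X, exp iξ𝐇_j(□₀, B)). (4.2)»*, DERIVED on the concrete carrier from its
  two printed inputs: the representation (3.37) p. 277 *«U_j(□₀, exp iτQ(…)) = (exp iξ𝐇_j(□₀, τQ(…)))^{u_j}»* as the hypothesis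
  `U_j(□₀, exp iB) = (exp iξ𝐇)^u` (`B12RegularSpaces111.gaugeU u (sub310 ξ 𝐇 1)`), and the gauge invariance (1.19) p. 263
  *«𝐄^{(j)}(X, g_{j−1}, 𝐔^u, R(u)𝐉) = 𝐄^{(j)}(X, g_{j−1}, 𝐔, 𝐉)»* of `E` under the action (1.10) `act u`; mechanism =
  `B12Eq18Current.invariant_comp_ofBackground` (`J(𝐔^u) = R(u)J(𝐔)`, for `π` commuting with `R(u(x))`);
* **`eq43_concrete_torusIntegral`** — for that outer map, an inner map `𝐇 : W → Cfg44 …` (`B ↦ 𝐇_j(□₀, B)`, abstract as in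
  `B12Repr43`) of class `Cⁿ` at `0` with `𝐇(0) = 0`, arguments `B_1,…,B_n`, and for every set partition `c` of `{1,…,n}` radii
  `ρ_c > 0` whose closed polydisc spanned by the block insertions `v_p(c) = ⟨δ^{n(p)}𝐇(0), ⊗_{i∈N(p)}B_i⟩` lies in the ball
  `{‖𝐀‖₍₄.₄₎ < α₂}`:  `Dⁿ(𝐄∘𝐇)(0)[B_1,…,B_n] = Σ_c (2πi)^{-r(c)} ∯_{T(0,ρ_c)} Π_pτ_p^{-2} 𝐄(Σ_p τ_p v_p(c)) dτ`
  (`B12Eq43ContourFormula.faaDiBruno_torusIntegral` with `U := ball 0 α₂`);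
* **`eq43_concrete_contourIter`** — the same in print's nested shape `Σ_c Π_p (1/2πi)∮_{|τ_p|=ρ_p(c)} dτ_p/τ_p² 𝐄(Σ_p τ_p v_p(c))`;
* `eq43_concrete_of_radii` — with the p. 282 radii `ρ_p(c) = α₂/(2 r(c) β_p(c))` for any bounds `‖v_p(c)‖₍₄.₄₎ ≤ β_p(c)`,
  `β_p(c) > 0` (print: *«The norm in (4.4) of the expression ⟨δ^{n(p)}/δB^{n(p)}𝐇_j(□₀,0), ⊗_{i∈N(p)}B_i⟩ can be estimated by
  B₃Π_{i∈N(p)}|B_i|»*, p. 282 — `β` abstract here), via `B12Eq43ContourFormula.polydisc_subset_ball_of_radii`.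
MODELLING / HONEST SCOPE: as `B12Eq44Ball` §6 — `𝐇_j(□₀,·)` is NOT constructed (an abstract `Cⁿ` map with `𝐇(0) = 0`, [15]);
nothing of (4.5) or of the p. 282 block bounds is used or claimed.  Mega-formalization `lit-balaban`, HOME `run/shared/lean/pub/lit-balaban/`,
Phase-2 proof seat p05 gen 8 (unit `lit-balaban-p05`).  Imports `…B12Eq43ContourFormula` (p05 g8) and `…B12Eq44Ball` (p05 g7) only;
modifies nothing there.
-/

noncomputable section

open Set Metric Filter Finset Complex MeasureTheory
open scoped Topology BigOperators

namespace Literature.MathematicalPhysics.QuantumFieldTheory.Balaban1983to89.B12Eq43ConcreteChain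

open Literature.MathematicalPhysics.QuantumFieldTheory.Balaban1983to89
open B12Ineq45 B12Repr43 B12Eq43ContourFormula B9Eq39Adjoint B12RegularSpaces111 B12Eq18Current B12Eq311CurrentExpansion
  B12Eq44Space B12Eq44Ball

variable {P : Params} {i : ℕ} {𝔸 : Type*} [NormedRing 𝔸] [NormedAlgebra ℂ 𝔸] [CompleteSpace 𝔸] [NormOneClass 𝔸]
  {V : Type*} [NormedAddCommGroup V] [NormedSpace ℂ V] [CompleteSpace V]
  {W : Type*} [NormedAddCommGroup W] [NormedSpace ℂ W]

omit [NormOneClass 𝔸] in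
/-- **(4.2) on the concrete carrier**: *«Using the gauge transformation in (3.37), and the gauge invariance of the function 𝐄^{(j)}(X, U),
we have 𝐄^{(j)}(X, U_j(□₀, exp iB)) = 𝐄^{(j)}(X, exp iξ𝐇_j(□₀, B)) (4.2)»* — for `E` invariant under the gauge action (1.10) of `u`
((1.19), with `π` commuting with the adjoint action of the values of `u`) and `U_j(□₀, exp iB) = (exp iξ𝐇)^u` ((3.37), as data):
`E(U_j, J(U_j)) = E(exp iξ𝐇, J(exp iξ𝐇))`. [cite: Balaban1987RG1, (4.2) p.281] -/
theorem eq42_concrete {β : Sort*} {π : 𝔸 →ₗ[ℂ] 𝔸} (ξ : ℝ) (E : (PBond P i → 𝔸) × (PBond P i → 𝔸) → β)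
    (u : Site P i → 𝔸ˣ) (hπ : ∀ x X, π (R (u x) X) = R (u x) (π X))
    (hE : ∀ Φ : FieldPair P i 𝔸ˣ 𝔸, E ((fun b => ((act u Φ).U b : 𝔸)), (act u Φ).J) = E ((fun b => (Φ.U b : 𝔸)), Φ.J))
    {Uj : PBond P i → 𝔸ˣ} {H : PBond P i → 𝔸} (h337 : Uj = gaugeU u (sub310 ξ H (1 : PBond P i → 𝔸ˣ))) :
    E ((fun b => ((ofBackground π ξ Uj).U b : 𝔸)), (ofBackground π ξ Uj).J)
      = E ((fun b => ((ofBackground π ξ (sub310 ξ H (1 : PBond P i → 𝔸ˣ))).U b : 𝔸)),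
          (ofBackground π ξ (sub310 ξ H (1 : PBond P i → 𝔸ˣ))).J) := by
  rw [h337]
  exact invariant_comp_ofBackground (fun Φ : FieldPair P i 𝔸ˣ 𝔸 => E ((fun b => (Φ.U b : 𝔸)), Φ.J)) π ξ u hπ hE _

/-- **The whole chain (4.3) on the concrete (4.4)-carrier, joint (torus-integral) form.**  Outer map = `B12Eq44Ball`'s
`𝐀 ↦ E((exp iξ𝐀, J(exp iξ𝐀)))` on the (4.4)-normed Landau space (analytic on `{‖𝐀‖₍₄.₄₎ < α₂}` under the listed hypotheses of
`analyticOnNhd_E_sub310_one_ball`); inner map `𝐇` abstract, `Cⁿ` at `0`, `𝐇(0) = 0`; radii `ρ_c > 0` per partition with the closed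
polydisc of the block insertions inside that ball:
`Dⁿ(𝐄∘𝐇)(0)[B] = Σ_c (2πi)^{-r(c)} ∯_{T(0,ρ_c)} Π_pτ_p^{-2} 𝐄(Σ_p τ_p ⟨δ^{n(p)}𝐇(0), ⊗_{i∈N(p)}B_i⟩) dτ`.
[cite: Balaban1987RG1, (4.3)–(4.4) p.281] -/
theorem eq43_concrete_torusIntegral (𝓜 : Model 𝔸) {F : Frame P i 𝔸} {c : StepConsts} {π : 𝔸 →ₗ[ℂ] 𝔸}
    {Rop Pop : (Site P i → 𝔸) →ₗ[ℂ] (Site P i → 𝔸)} {α₀ α₁ α₂ Cπ : ℝ}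
    (hξ : 0 < c.ξ) (hξ1 : c.ξ ≤ 1) (hcB : 0 < c.cB) (hα₀ : 0 < α₀) (hα₀1 : α₀ ≤ 1) (hα₂ : 0 < α₂)
    (hα₂q : α₂ ≤ 1 / 4) (hα₂α₁ : α₂ ≤ α₁) (h8 : 8 * α₂ < α₀) (hCπ : 0 ≤ Cπ) (hπn : ∀ X, ‖π X‖ ≤ Cπ * ‖X‖)
    (hπgc : ∀ X, π X ∈ 𝓜.gc) (hgcAd : ∀ g ∈ 𝓜.Gc, ∀ X ∈ 𝓜.gc, R g X ∈ 𝓜.gc) (heGc : ∀ a ∈ 𝓜.gc, expI c.ξ a ∈ 𝓜.Gc)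
    (hRP : ∀ f : Site P i → 𝔸, Rop f + Pop f = f)
    (hres : (2 + (P.d - 1) * (Cπ * (C311 1 + 2 * 1 ^ 14))) * α₂ ≤ α₀)
    (E : (PBond P i → 𝔸) × (PBond P i → 𝔸) → V)
    (hE : ∀ Φ ∈ space' 𝓜 F c α₀ α₁, AnalyticAt ℂ E ((fun b => (Φ.U b : 𝔸)), Φ.J))
    (hIV₁ : CondIV F.bg F.X₂ c α₀ (1 : PBond P i → 𝔸ˣ))
    (hIV : ∀ A ∈ space44 π Pop c.ξ α₂, CondIV F.bg F.X₂ c α₀ (sub310 c.ξ A (1 : PBond P i → 𝔸ˣ)))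
    {H : W → Cfg44 π Pop c.ξ (landauSub 𝓜 Rop c.ξ)} {n : ℕ} (hH : ContDiffAt ℂ n H 0) (hH0 : H 0 = 0) (B : Fin n → W)
    (ρ : (q : OrderedFinpartition n) → Fin q.length → ℝ) (hρ : ∀ q p, 0 < ρ q p)
    (hsub : ∀ q, polydisc (0 : Cfg44 π Pop c.ξ (landauSub 𝓜 Rop c.ξ)) (blockIns (𝕜 := ℂ) H 0 B q) (ρ q) ⊆ ball 0 α₂) :
    iteratedFDeriv ℂ n (((fun A : PBond P i → 𝔸 =>
      E ((fun b => ((ofBackground π c.ξ (sub310 c.ξ A (1 : PBond P i → 𝔸ˣ))).U b : 𝔸)),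
        (ofBackground π c.ξ (sub310 c.ξ A (1 : PBond P i → 𝔸ˣ))).J)) ∘ Cfg44.incl π Pop c.ξ (landauSub 𝓜 Rop c.ξ)) ∘ H) 0 B
      = ∑ q : OrderedFinpartition n, ((2 * Real.pi * I)⁻¹) ^ q.length •
          ∯ τ in T(0, ρ q), (∏ p, 1 / τ p ^ 2) •
            ((fun A : PBond P i → 𝔸 =>
              E ((fun b => ((ofBackground π c.ξ (sub310 c.ξ A (1 : PBond P i → 𝔸ˣ))).U b : 𝔸)),
                (ofBackground π c.ξ (sub310 c.ξ A (1 : PBond P i → 𝔸ˣ))).J)) ∘ Cfg44.incl π Pop c.ξ (landauSub 𝓜 Rop c.ξ))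
              (∑ p, τ p • blockIns (𝕜 := ℂ) H 0 B q p) :=
  faaDiBruno_torusIntegral Metric.isOpen_ball (mem_ball_self hα₂)
    (analyticOnNhd_E_sub310_one_ball 𝓜 hξ hξ1 hcB hα₀ hα₀1 hα₂ hα₂q hα₂α₁ h8 hCπ hπn hπgc hgcAd heGc hRP hres E hE hIV₁ hIV)
    hH hH0 B ρ hρ hsub

/-- **The whole chain (4.3) on the concrete (4.4)-carrier, print's nested shape**: the same with each term the product of contour
integrals `Π_p (1/2πi)∮_{|τ_p|=ρ_p(c)} dτ_p/τ_p²` (`B12Eq43ContourFormula.contourIter`). [cite: Balaban1987RG1, (4.3)–(4.4) p.281] -/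
theorem eq43_concrete_contourIter (𝓜 : Model 𝔸) {F : Frame P i 𝔸} {c : StepConsts} {π : 𝔸 →ₗ[ℂ] 𝔸}
    {Rop Pop : (Site P i → 𝔸) →ₗ[ℂ] (Site P i → 𝔸)} {α₀ α₁ α₂ Cπ : ℝ}
    (hξ : 0 < c.ξ) (hξ1 : c.ξ ≤ 1) (hcB : 0 < c.cB) (hα₀ : 0 < α₀) (hα₀1 : α₀ ≤ 1) (hα₂ : 0 < α₂)
    (hα₂q : α₂ ≤ 1 / 4) (hα₂α₁ : α₂ ≤ α₁) (h8 : 8 * α₂ < α₀) (hCπ : 0 ≤ Cπ) (hπn : ∀ X, ‖π X‖ ≤ Cπ * ‖X‖)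
    (hπgc : ∀ X, π X ∈ 𝓜.gc) (hgcAd : ∀ g ∈ 𝓜.Gc, ∀ X ∈ 𝓜.gc, R g X ∈ 𝓜.gc) (heGc : ∀ a ∈ 𝓜.gc, expI c.ξ a ∈ 𝓜.Gc)
    (hRP : ∀ f : Site P i → 𝔸, Rop f + Pop f = f)
    (hres : (2 + (P.d - 1) * (Cπ * (C311 1 + 2 * 1 ^ 14))) * α₂ ≤ α₀)
    (E : (PBond P i → 𝔸) × (PBond P i → 𝔸) → V)
    (hE : ∀ Φ ∈ space' 𝓜 F c α₀ α₁, AnalyticAt ℂ E ((fun b => (Φ.U b : 𝔸)), Φ.J))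
    (hIV₁ : CondIV F.bg F.X₂ c α₀ (1 : PBond P i → 𝔸ˣ))
    (hIV : ∀ A ∈ space44 π Pop c.ξ α₂, CondIV F.bg F.X₂ c α₀ (sub310 c.ξ A (1 : PBond P i → 𝔸ˣ)))
    {H : W → Cfg44 π Pop c.ξ (landauSub 𝓜 Rop c.ξ)} {n : ℕ} (hH : ContDiffAt ℂ n H 0) (hH0 : H 0 = 0) (B : Fin n → W)
    (ρ : (q : OrderedFinpartition n) → Fin q.length → ℝ) (hρ : ∀ q p, 0 < ρ q p)
    (hsub : ∀ q, polydisc (0 : Cfg44 π Pop c.ξ (landauSub 𝓜 Rop c.ξ)) (blockIns (𝕜 := ℂ) H 0 B q) (ρ q) ⊆ ball 0 α₂) :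
    iteratedFDeriv ℂ n (((fun A : PBond P i → 𝔸 =>
      E ((fun b => ((ofBackground π c.ξ (sub310 c.ξ A (1 : PBond P i → 𝔸ˣ))).U b : 𝔸)),
        (ofBackground π c.ξ (sub310 c.ξ A (1 : PBond P i → 𝔸ˣ))).J)) ∘ Cfg44.incl π Pop c.ξ (landauSub 𝓜 Rop c.ξ)) ∘ H) 0 B
      = ∑ q : OrderedFinpartition n, contourIter q.length (blockIns (𝕜 := ℂ) H 0 B q) (ρ q)
          ((fun A : PBond P i → 𝔸 =>
              E ((fun b => ((ofBackground π c.ξ (sub310 c.ξ A (1 : PBond P i → 𝔸ˣ))).U b : 𝔸)),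
                (ofBackground π c.ξ (sub310 c.ξ A (1 : PBond P i → 𝔸ˣ))).J)) ∘ Cfg44.incl π Pop c.ξ (landauSub 𝓜 Rop c.ξ)) 0 :=
  faaDiBruno_contourIter Metric.isOpen_ball (mem_ball_self hα₂)
    (analyticOnNhd_E_sub310_one_ball 𝓜 hξ hξ1 hcB hα₀ hα₀1 hα₂ hα₂q hα₂α₁ h8 hCπ hπn hπgc hgcAd heGc hRP hres E hE hIV₁ hIV)
    hH hH0 B ρ hρ hsub

/-- **With the radii of p. 282**: for any bounds `‖v_p(c)‖₍₄.₄₎ ≤ β_p(c)` with `β_p(c) > 0` on the block insertions (print: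
*«can be estimated by B₃ Π_{i∈N(p)} |B_i|»*, p. 282), the contours `|τ_p| = α₂/(2 r(c) β_p(c))` are admissible, and (4.3) on the
concrete carrier reads `Dⁿ(𝐄∘𝐇)(0)[B] = Σ_c (2πi)^{-r(c)} ∯_{T(0,(α₂/(2r(c)β_p(c)))_p)} Π_pτ_p^{-2} 𝐄(Σ_p τ_p v_p(c)) dτ`.
[cite: Balaban1987RG1, (4.3)–(4.5) pp.281–282] -/
theorem eq43_concrete_of_radii (𝓜 : Model 𝔸) {F : Frame P i 𝔸} {c : StepConsts} {π : 𝔸 →ₗ[ℂ] 𝔸}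
    {Rop Pop : (Site P i → 𝔸) →ₗ[ℂ] (Site P i → 𝔸)} {α₀ α₁ α₂ Cπ : ℝ}
    (hξ : 0 < c.ξ) (hξ1 : c.ξ ≤ 1) (hcB : 0 < c.cB) (hα₀ : 0 < α₀) (hα₀1 : α₀ ≤ 1) (hα₂ : 0 < α₂)
    (hα₂q : α₂ ≤ 1 / 4) (hα₂α₁ : α₂ ≤ α₁) (h8 : 8 * α₂ < α₀) (hCπ : 0 ≤ Cπ) (hπn : ∀ X, ‖π X‖ ≤ Cπ * ‖X‖)
    (hπgc : ∀ X, π X ∈ 𝓜.gc) (hgcAd : ∀ g ∈ 𝓜.Gc, ∀ X ∈ 𝓜.gc, R g X ∈ 𝓜.gc) (heGc : ∀ a ∈ 𝓜.gc, expI c.ξ a ∈ 𝓜.Gc)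
    (hRP : ∀ f : Site P i → 𝔸, Rop f + Pop f = f)
    (hres : (2 + (P.d - 1) * (Cπ * (C311 1 + 2 * 1 ^ 14))) * α₂ ≤ α₀)
    (E : (PBond P i → 𝔸) × (PBond P i → 𝔸) → V)
    (hE : ∀ Φ ∈ space' 𝓜 F c α₀ α₁, AnalyticAt ℂ E ((fun b => (Φ.U b : 𝔸)), Φ.J))
    (hIV₁ : CondIV F.bg F.X₂ c α₀ (1 : PBond P i → 𝔸ˣ))
    (hIV : ∀ A ∈ space44 π Pop c.ξ α₂, CondIV F.bg F.X₂ c α₀ (sub310 c.ξ A (1 : PBond P i → 𝔸ˣ)))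
    {H : W → Cfg44 π Pop c.ξ (landauSub 𝓜 Rop c.ξ)} {n : ℕ} (hH : ContDiffAt ℂ n H 0) (hH0 : H 0 = 0) (B : Fin n → W)
    (β : (q : OrderedFinpartition n) → Fin q.length → ℝ) (hβ : ∀ q p, 0 < β q p)
    (hv : ∀ q p, ‖blockIns (𝕜 := ℂ) H 0 B q p‖ ≤ β q p) :
    iteratedFDeriv ℂ n (((fun A : PBond P i → 𝔸 =>
      E ((fun b => ((ofBackground π c.ξ (sub310 c.ξ A (1 : PBond P i → 𝔸ˣ))).U b : 𝔸)),
        (ofBackground π c.ξ (sub310 c.ξ A (1 : PBond P i → 𝔸ˣ))).J)) ∘ Cfg44.incl π Pop c.ξ (landauSub 𝓜 Rop c.ξ)) ∘ H) 0 B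
      = ∑ q : OrderedFinpartition n, ((2 * Real.pi * I)⁻¹) ^ q.length •
          ∯ τ in T(0, fun p => α₂ / (2 * q.length * β q p)), (∏ p, 1 / τ p ^ 2) •
            ((fun A : PBond P i → 𝔸 =>
              E ((fun b => ((ofBackground π c.ξ (sub310 c.ξ A (1 : PBond P i → 𝔸ˣ))).U b : 𝔸)),
                (ofBackground π c.ξ (sub310 c.ξ A (1 : PBond P i → 𝔸ˣ))).J)) ∘ Cfg44.incl π Pop c.ξ (landauSub 𝓜 Rop c.ξ))
              (∑ p, τ p • blockIns (𝕜 := ℂ) H 0 B q p) := by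
  have hrpos : ∀ (q : OrderedFinpartition n) (p : Fin q.length), (0 : ℝ) < q.length := fun q p => by
    exact_mod_cast Fin.pos p
  refine eq43_concrete_torusIntegral 𝓜 hξ hξ1 hcB hα₀ hα₀1 hα₂ hα₂q hα₂α₁ h8 hCπ hπn hπgc hgcAd heGc hRP hres E hE hIV₁ hIV
    hH hH0 B (fun q p => α₂ / (2 * q.length * β q p)) (fun q p => div_pos hα₂ (by nlinarith [hrpos q p, hβ q p])) fun q => ?_
  simpa using polydisc_subset_ball_of_radii (0 : Cfg44 π Pop c.ξ (landauSub 𝓜 Rop c.ξ)) (blockIns (𝕜 := ℂ) H 0 B q) hα₂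
    (β q) (hβ q) (hv q)

end Literature.MathematicalPhysics.QuantumFieldTheory.Balaban1983to89.B12Eq43ConcreteChain

end
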